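import Literature.Probability.LatticeModels.CollarLegModel

/-!
# Stub `stub_rigidity_of_local_laws` of line `rainbow-monomials-in-excursion-kernels` — Part 5:
# the boundary cycle of a general lattice domain (`CollarLegModel.dsucc / period / cycle / outDart`)

Crux `BoundaryDefectGaussianR` (stmt-CriticalPhenomena-14132). Geometry-free facts about the
counter-clockwise boundary walk of `Literature.Probability.LatticeModels.CollarLegModel` on an
ARBITRARY finite `V ⊂ ℤ²` (the box case is Part 1 of stub 4), on which the TRANSPORT hypothesis of
the conditional rigidity theorem `s3_rigidityOfTransport` (Part 4 of this stub) rests: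

* `s3_dsucc_exterior`, `s3_dsucc_injective` — `dsucc V` maps exterior darts (`v ∈ V`,
  `v + dir k ∉ V`) to exterior darts and is injective there (the clockwise walk is a left inverse);
* `s3_dsucc_iterate` — iterates stay exterior; each iterate is injective on exterior darts;
* `s3_period_spec` — `period V d` of an exterior dart is a genuine minimal period: positive,
  `≤ 4|V|`, `(dsucc V)^[period] d = d`, no earlier return (pigeonhole + the defining `List.find?`);
* `s3_cycle_orbit` — `cycle V d` is the orbit: members are the iterates, all iterates are members
  (reduction mod the period), no duplicates, closed under exterior predecessors, and the cycle
  through any member is the same cycle (same period, same members) — so sliding the SINK along the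
  boundary does not change which vertices the walk meets;
* `s3_outDart_some` — `outDart V x = some d` gives a dart at `x` pointing out of `V`.

Part 6 builds the admissibility criterion on these; the rewriting rules `s3_dsucc_cases` and the
step bound `s3_dsucc_iterate_dist` ride with Parts 4 and 3.
-/

noncomputable section

namespace Summit.CriticalPhenomena.CardyFormulaZ2.Cruxes.BoundaryDefectGaussianR.RainbowMonomialsInExcursionKernels

open Literature.Probability.LatticeModels Literature.Probability.LatticeModels.CollarLegModel

/-- **The boundary successor preserves exterior darts.** If `d = (v, k)` is an exterior dart of `V`
(`v ∈ V`, `v + dir k ∉ V`) then so is `dsucc V d` (turn at a convex corner / go straight / turn back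
at a reflex corner). [folklore] -/
theorem s3_dsucc_exterior :
    ∀ (V : Finset (ℤ × ℤ)) (d : Literature.Probability.LatticeModels.CollarLegModel.Dart), d.1 ∈ V →
    Literature.Probability.LatticeModels.CollarLegModel.dartTip d ∉ V →
    (Literature.Probability.LatticeModels.CollarLegModel.dsucc V d).1 ∈ V ∧
    Literature.Probability.LatticeModels.CollarLegModel.dartTip
      (Literature.Probability.LatticeModels.CollarLegModel.dsucc V d) ∉ V := by
  rintro V ⟨v, k⟩ hv ht
  simp only [dartTip] at ht ⊢
  have n3 : ∀ k : Fin 4, dir (k + 3) = -dir (k + 1) := by decide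
  by_cases hA : v + dir (k + 1) ∈ V
  · by_cases hB : v + dir (k + 1) + dir k ∈ V
    · have hds : dsucc V (v, k) = (v + dir (k + 1) + dir k, k + 3) := by simp [dsucc, hA, hB]
      rw [hds, n3]
      refine ⟨hB, ?_⟩
      have : v + dir (k + 1) + dir k + -dir (k + 1) = v + dir k := by abel
      rw [this]
      exact ht
    · have hds : dsucc V (v, k) = (v + dir (k + 1), k) := by simp [dsucc, hA, hB]
      rw [hds]
      exact ⟨hA, hB⟩
  · have hds : dsucc V (v, k) = (v, k + 1) := by simp [dsucc, hA]
    rw [hds]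
    exact ⟨hv, hA⟩

/-- **The boundary successor is injective on exterior darts** (the clockwise walk — turn back /
go straight / turn, read backwards — is a left inverse). Consequently the orbit of an exterior
dart under `dsucc V` is a genuine cycle. [folklore] -/
theorem s3_dsucc_injective :
    ∀ (V : Finset (ℤ × ℤ)) (d d' : Literature.Probability.LatticeModels.CollarLegModel.Dart), d.1 ∈ V →
    Literature.Probability.LatticeModels.CollarLegModel.dartTip d ∉ V → d'.1 ∈ V →
    Literature.Probability.LatticeModels.CollarLegModel.dartTip d' ∉ V →
    Literature.Probability.LatticeModels.CollarLegModel.dsucc V d =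
      Literature.Probability.LatticeModels.CollarLegModel.dsucc V d' → d = d' := by
  intro V
  -- the clockwise predecessor
  let g : Dart → Dart := fun e ↦
    if e.1 + dir (e.2 + 3) ∉ V then (e.1, e.2 + 3)
    else if e.1 + dir (e.2 + 3) + dir e.2 ∉ V then (e.1 + dir (e.2 + 3), e.2)
    else (e.1 + dir (e.2 + 3) + dir e.2, e.2 + 1)
  have n2 : ∀ k : Fin 4, dir (k + 2) = -dir k := by decide
  have n3 : ∀ k : Fin 4, dir (k + 3) = -dir (k + 1) := by decide
  have f13 : ∀ k : Fin 4, k + 1 + 3 = k := by decide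
  have f31 : ∀ k : Fin 4, k + 3 + 1 = k := by decide
  have f33 : ∀ k : Fin 4, k + 3 + 3 = k + 2 := by decide
  have hg : ∀ d : Dart, d.1 ∈ V → dartTip d ∉ V → g (dsucc V d) = d := by
    rintro ⟨v, k⟩ hv ht
    simp only [dartTip] at ht hv
    by_cases hA : v + dir (k + 1) ∈ V
    · by_cases hB : v + dir (k + 1) + dir k ∈ V
      · -- reflex: dsucc = (v + dir (k+1) + dir k, k + 3)
        have hds : dsucc V (v, k) = (v + dir (k + 1) + dir k, k + 3) := by simp [dsucc, hA, hB]
        have p1 : v + dir (k + 1) + dir k + dir (k + 3 + 3) = v + dir (k + 1) := by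
          rw [f33, n2]; abel
        have p2 : v + dir (k + 1) + dir (k + 3) = v := by rw [n3]; abel
        rw [hds]
        simp only [g]
        rw [p1, if_neg (not_not.2 hA), p2, if_neg (not_not.2 hv), f31]
      · -- straight: dsucc = (v + dir (k+1), k)
        have hds : dsucc V (v, k) = (v + dir (k + 1), k) := by simp [dsucc, hA, hB]
        have p2 : v + dir (k + 1) + dir (k + 3) = v := by rw [n3]; abel
        rw [hds]
        simp only [g]
        rw [p2, if_neg (not_not.2 hv), if_pos ht]
    · -- convex turn: dsucc = (v, k + 1)
      have hds : dsucc V (v, k) = (v, k + 1) := by simp [dsucc, hA]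
      rw [hds]
      simp only [g]
      rw [f13, if_pos ht]
  intro d d' hd hdt hd' hd't heq
  have := congrArg g heq
  rwa [hg d hd hdt, hg d' hd' hd't] at this

/-- **Iterates of the boundary successor.** From an exterior dart all iterates of `dsucc V` are
exterior darts, and each iterate `(dsucc V)^[i]` is injective on exterior darts. [folklore] -/
theorem s3_dsucc_iterate :
    ∀ (V : Finset (ℤ × ℤ)) (i : ℕ),
    (∀ d : Literature.Probability.LatticeModels.CollarLegModel.Dart, d.1 ∈ V →
      Literature.Probability.LatticeModels.CollarLegModel.dartTip d ∉ V →
      ((Literature.Probability.LatticeModels.CollarLegModel.dsucc V)^[i] d).1 ∈ V ∧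
      Literature.Probability.LatticeModels.CollarLegModel.dartTip
        ((Literature.Probability.LatticeModels.CollarLegModel.dsucc V)^[i] d) ∉ V) ∧
    (∀ d d' : Literature.Probability.LatticeModels.CollarLegModel.Dart, d.1 ∈ V →
      Literature.Probability.LatticeModels.CollarLegModel.dartTip d ∉ V → d'.1 ∈ V →
      Literature.Probability.LatticeModels.CollarLegModel.dartTip d' ∉ V →
      (Literature.Probability.LatticeModels.CollarLegModel.dsucc V)^[i] d =
        (Literature.Probability.LatticeModels.CollarLegModel.dsucc V)^[i] d' → d = d') := by
  intro V i
  induction i with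
  | zero => exact ⟨fun d hv ht ↦ ⟨hv, ht⟩, fun d d' _ _ _ _ h ↦ h⟩
  | succ i ih =>
    refine ⟨fun d hv ht ↦ ?_, fun d d' hd hdt hd' hd't h ↦ ?_⟩
    · rw [Function.iterate_succ_apply']
      exact s3_dsucc_exterior V _ (ih.1 d hv ht).1 (ih.1 d hv ht).2
    · rw [Function.iterate_succ_apply, Function.iterate_succ_apply] at h
      have h1 := s3_dsucc_exterior V d hd hdt
      have h2 := s3_dsucc_exterior V d' hd' hd't
      exact s3_dsucc_injective V d d' hd hdt hd' hd't (ih.2 _ _ h1.1 h1.2 h2.1 h2.2 h)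

/-- **The period of an exterior dart.** For an exterior dart `d` of `V`, `period V d` is a genuine
minimal period of `d` under `dsucc V`: it is positive, at most `4|V|` (the number of darts at
vertices of `V`), `(dsucc V)^[period] d = d`, and no smaller positive iterate returns to `d`
(pigeonhole on the injective map `dsucc V` of the finite set of exterior darts, and the defining
`List.find?`). [folklore] -/
theorem s3_period_spec :
    ∀ (V : Finset (ℤ × ℤ)) (d : Literature.Probability.LatticeModels.CollarLegModel.Dart), d.1 ∈ V →
    Literature.Probability.LatticeModels.CollarLegModel.dartTip d ∉ V →
    0 < Literature.Probability.LatticeModels.CollarLegModel.period V d ∧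
    Literature.Probability.LatticeModels.CollarLegModel.period V d ≤ 4 * V.card ∧
    (Literature.Probability.LatticeModels.CollarLegModel.dsucc V)^[
      Literature.Probability.LatticeModels.CollarLegModel.period V d] d = d ∧
    ∀ m, 0 < m → m < Literature.Probability.LatticeModels.CollarLegModel.period V d →
      (Literature.Probability.LatticeModels.CollarLegModel.dsucc V)^[m] d ≠ d := by
  intro V d hv ht
  set X : Finset Dart := (V ×ˢ (Finset.univ : Finset (Fin 4))).filter (fun e ↦ dartTip e ∉ V)
    with hX
  have hXcard : X.card ≤ 4 * V.card := by
    calc X.card ≤ (V ×ˢ (Finset.univ : Finset (Fin 4))).card := Finset.card_filter_le _ _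
      _ = 4 * V.card := by rw [Finset.card_product]; simp [mul_comm]
  have hmemX : ∀ e : Dart, e.1 ∈ V → dartTip e ∉ V → e ∈ X := by
    intro e he het
    simp only [hX, Finset.mem_filter, Finset.mem_product, Finset.mem_univ, and_true]
    exact ⟨he, het⟩
  have hiter := fun i ↦ (s3_dsucc_iterate V i).1 d hv ht
  have hret : ∃ n, 0 < n ∧ n ≤ 4 * V.card ∧ (dsucc V)^[n] d = d := by
    have hmaps : ∀ i ∈ Finset.range (4 * V.card + 1), (dsucc V)^[i] d ∈ X :=
      fun i _ ↦ hmemX _ (hiter i).1 (hiter i).2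
    have hlt : X.card < (Finset.range (4 * V.card + 1)).card := by
      rw [Finset.card_range]; omega
    obtain ⟨i, hi, j, hj, hne, hij⟩ := Finset.exists_ne_map_eq_of_card_lt_of_maps_to hlt hmaps
    have hi' := Finset.mem_range.1 hi
    have hj' := Finset.mem_range.1 hj
    rcases lt_or_gt_of_ne hne with h | h
    · refine ⟨j - i, Nat.sub_pos_of_lt h, by omega, ?_⟩
      apply (s3_dsucc_iterate V i).2 _ _ (hiter _).1 (hiter _).2 hv ht
      rw [← Function.iterate_add_apply, Nat.add_sub_cancel' h.le]
      exact hij.symm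
    · refine ⟨i - j, Nat.sub_pos_of_lt h, by omega, ?_⟩
      apply (s3_dsucc_iterate V j).2 _ _ (hiter _).1 (hiter _).2 hv ht
      rw [← Function.iterate_add_apply, Nat.add_sub_cancel' h.le]
      exact hij
  obtain ⟨n, hn0, hnle, hnret⟩ := hret
  have hsome : ((List.range (4 * V.card + 1)).find?
      fun m => decide (0 < m ∧ (dsucc V)^[m] d = d)).isSome := by
    rw [List.find?_isSome]
    exact ⟨n, List.mem_range.2 (by omega), by simp [hn0, hnret]⟩
  obtain ⟨n₀, hn₀⟩ := Option.isSome_iff_exists.1 hsome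
  obtain ⟨hp, hmem, hmin⟩ := List.find?_range_eq_some.1 hn₀
  have hper : period V d = n₀ := by
    simp only [period]
    rw [hn₀]
    rfl
  simp only [decide_eq_true_eq] at hp
  rw [hper]
  refine ⟨hp.1, ?_, hp.2, ?_⟩
  · have := List.mem_range.1 hmem
    omega
  · intro m hm0 hml heq
    have := hmin m hml
    simp [hm0, heq] at this

/-- **The boundary cycle of an exterior dart is its orbit.** For an exterior dart `d` of `V` with
period `P = period V d`: membership in `cycle V d` means being an iterate `(dsucc V)^[m] d`, `m < P`;
ALL iterates lie on the cycle (reduction mod `P`); the cycle has no duplicates; it is closed under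
predecessors among exterior darts; and the cycle through any of its darts is the same cycle up to
rotation (same period, same members). [folklore] -/
theorem s3_cycle_orbit :
    ∀ (V : Finset (ℤ × ℤ)) (d : Literature.Probability.LatticeModels.CollarLegModel.Dart), d.1 ∈ V →
    Literature.Probability.LatticeModels.CollarLegModel.dartTip d ∉ V →
    (∀ e, e ∈ Literature.Probability.LatticeModels.CollarLegModel.cycle V d ↔
      ∃ m, m < Literature.Probability.LatticeModels.CollarLegModel.period V d ∧
        (Literature.Probability.LatticeModels.CollarLegModel.dsucc V)^[m] d = e) ∧
    (∀ m, (Literature.Probability.LatticeModels.CollarLegModel.dsucc V)^[m] d =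
      (Literature.Probability.LatticeModels.CollarLegModel.dsucc V)^[m %
        Literature.Probability.LatticeModels.CollarLegModel.period V d] d) ∧
    (∀ m, (Literature.Probability.LatticeModels.CollarLegModel.dsucc V)^[m] d ∈
      Literature.Probability.LatticeModels.CollarLegModel.cycle V d) ∧
    (Literature.Probability.LatticeModels.CollarLegModel.cycle V d).Nodup ∧
    (∀ e : Literature.Probability.LatticeModels.CollarLegModel.Dart, e.1 ∈ V →
      Literature.Probability.LatticeModels.CollarLegModel.dartTip e ∉ V →
      Literature.Probability.LatticeModels.CollarLegModel.dsucc V e ∈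
        Literature.Probability.LatticeModels.CollarLegModel.cycle V d →
      e ∈ Literature.Probability.LatticeModels.CollarLegModel.cycle V d) ∧
    (∀ e, e ∈ Literature.Probability.LatticeModels.CollarLegModel.cycle V d →
      Literature.Probability.LatticeModels.CollarLegModel.period V e =
        Literature.Probability.LatticeModels.CollarLegModel.period V d ∧
      ∀ x, x ∈ Literature.Probability.LatticeModels.CollarLegModel.cycle V e ↔
        x ∈ Literature.Probability.LatticeModels.CollarLegModel.cycle V d) := by
  intro V
  -- facts valid for every exterior dart
  have hmem : ∀ d : Dart, ∀ e, e ∈ cycle V d ↔ ∃ m, m < period V d ∧ (dsucc V)^[m] d = e := by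
    intro d e
    simp only [cycle, List.mem_iterate]
    constructor
    · rintro ⟨m, hm, rfl⟩; exact ⟨m, hm, rfl⟩
    · rintro ⟨m, hm, rfl⟩; exact ⟨m, hm, rfl⟩
  have hmod : ∀ d : Dart, d.1 ∈ V → dartTip d ∉ V →
      ∀ m, (dsucc V)^[m] d = (dsucc V)^[m % period V d] d := by
    intro d hv ht m
    obtain ⟨_, _, hret, _⟩ := s3_period_spec V d hv ht
    have hmul : ∀ q, (dsucc V)^[period V d * q] d = d := by
      intro q
      induction q with
      | zero => simp
      | succ q ih => rw [Nat.mul_succ, Function.iterate_add_apply, hret, ih]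
    conv_lhs => rw [← Nat.mod_add_div m (period V d), Function.iterate_add_apply, hmul]
  have hall : ∀ d : Dart, d.1 ∈ V → dartTip d ∉ V → ∀ m, (dsucc V)^[m] d ∈ cycle V d := by
    intro d hv ht m
    obtain ⟨hP0, -⟩ := s3_period_spec V d hv ht
    rw [hmem, hmod d hv ht m]
    exact ⟨m % period V d, Nat.mod_lt _ hP0, rfl⟩
  intro d hv ht
  obtain ⟨hP0, -, hret, hmin⟩ := s3_period_spec V d hv ht
  have hiter := fun i ↦ (s3_dsucc_iterate V i).1 d hv ht
  refine ⟨hmem d, hmod d hv ht, hall d hv ht, ?_, ?_, ?_⟩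
  · -- nodup
    rw [cycle, ← List.range_map_iterate]
    refine List.Nodup.map_on ?_ List.nodup_range
    intro i hi j hj hij
    have hi' := List.mem_range.1 hi
    have hj' := List.mem_range.1 hj
    by_contra hne
    rcases lt_or_gt_of_ne hne with h | h
    · refine hmin (j - i) (Nat.sub_pos_of_lt h) (by omega) ?_
      apply (s3_dsucc_iterate V i).2 _ _ (hiter _).1 (hiter _).2 hv ht
      rw [← Function.iterate_add_apply, Nat.add_sub_cancel' h.le]
      exact hij.symm
    · refine hmin (i - j) (Nat.sub_pos_of_lt h) (by omega) ?_
      apply (s3_dsucc_iterate V j).2 _ _ (hiter _).1 (hiter _).2 hv ht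
      rw [← Function.iterate_add_apply, Nat.add_sub_cancel' h.le]
      exact hij
  · -- closed under predecessors
    intro e he het hse
    obtain ⟨m, hm, hme⟩ := (hmem d _).1 hse
    rcases Nat.eq_zero_or_pos m with h0 | hpos
    · subst h0
      simp only [Function.iterate_zero, id_eq] at hme
      -- dsucc e = d = dsucc (dsucc^[P-1] d)
      have h1 : (dsucc V)^[period V d - 1 + 1] d = d := by
        rw [Nat.sub_add_cancel hP0]; exact hret
      rw [Function.iterate_succ_apply'] at h1
      have := s3_dsucc_injective V e ((dsucc V)^[period V d - 1] d) he het (hiter _).1 (hiter _).2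
        (hme.symm ▸ h1.symm)
      rw [this]
      exact hall d hv ht _
    · have h1 : (dsucc V)^[m - 1 + 1] d = dsucc V e := by
        rw [Nat.sub_add_cancel hpos]; exact hme
      rw [Function.iterate_succ_apply'] at h1
      have := s3_dsucc_injective V e ((dsucc V)^[m - 1] d) he het (hiter _).1 (hiter _).2 h1.symm
      rw [this]
      exact hall d hv ht _
  · -- rotation
    intro e he
    obtain ⟨m, hm, hme⟩ := (hmem d _).1 he
    have hev : e.1 ∈ V := hme ▸ (hiter m).1
    have het : dartTip e ∉ V := hme ▸ (hiter m).2
    have hsame : ∀ n, (dsucc V)^[n] e = e ↔ (dsucc V)^[n] d = d := by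
      intro n
      rw [← hme, ← Function.iterate_add_apply, Nat.add_comm, Function.iterate_add_apply]
      constructor
      · intro h
        exact (s3_dsucc_iterate V m).2 _ _ (hiter _).1 (hiter _).2 hv ht h
      · intro h
        rw [h]
    have hpe : period V e = period V d := by
      simp only [period]
      have : (fun n ↦ decide (0 < n ∧ (dsucc V)^[n] e = e)) =
          fun n ↦ decide (0 < n ∧ (dsucc V)^[n] d = d) := by
        funext n
        rw [decide_eq_decide]
        exact and_congr Iff.rfl (hsame n)
      rw [this]
    refine ⟨hpe, fun x ↦ ⟨fun hx ↦ ?_, fun hx ↦ ?_⟩⟩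
    · obtain ⟨i, _, hix⟩ := (hmem e _).1 hx
      rw [← hix, ← hme, ← Function.iterate_add_apply]
      exact hall d hv ht _
    · obtain ⟨i, _, hix⟩ := (hmem d _).1 hx
      have h1 : (dsucc V)^[period V d - m] e = d := by
        rw [← hme, ← Function.iterate_add_apply, Nat.sub_add_cancel hm.le, hret]
      have h2 : (dsucc V)^[i + (period V d - m)] e = x := by
        rw [Function.iterate_add_apply, h1, hix]
      rw [← h2]
      exact hall e hev het _

/-- **The exterior dart of a vertex.** If `outDart V x = some d` then `d` is a dart at `x` pointing
out of `V`. [folklore] -/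
theorem s3_outDart_some :
    ∀ (V : Finset (ℤ × ℤ)) (x : ℤ × ℤ) (d : Literature.Probability.LatticeModels.CollarLegModel.Dart),
    Literature.Probability.LatticeModels.CollarLegModel.outDart V x = some d →
    d.1 = x ∧ x + Literature.Probability.LatticeModels.CollarLegModel.dir d.2 ∉ V := by
  intro V x d h
  simp only [outDart, Option.map_eq_some_iff] at h
  obtain ⟨k, hk, rfl⟩ := h
  have := List.find?_some hk
  simp only [decide_eq_true_eq] at this
  exact ⟨rfl, this⟩

end Summit.CriticalPhenomena.CardyFormulaZ2.Cruxes.BoundaryDefectGaussianR.RainbowMonomialsInExcursionKernels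

end
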